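import Literature.NumberTheory.EllipticCurves.HeegnerPointsGenusHalfTraceProofs
import Literature.NumberTheory.EllipticCurves.HeegnerPointsClassNumberProofs
import Literature.NumberTheory.EllipticCurves.ComplexMultiplicationClassPolynomialRootProofs
import Literature.NumberTheory.EllipticCurves.X049EtaDescent
import Literature.NumberTheory.ComplexMultiplication.CMLatticeOrderOfDiscriminant
import Literature.NumberTheory.QuadraticFields.DedekindZetaReducedForms
import Mathlib.NumberTheory.ModularForms.Discriminant
import HarnessLib

set_option linter.dupNamespace false -- namespace `…BirchSwinnertonDyer.BirchSwinnertonDyer…` is the cell's (D-0017 nested layout)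
set_option autoImplicit false

/-!
# Twin″ (item 19140), LINE U, file U1 — the UNIT-CIRCLE LEMMA for the modular unit `x − 2 = η(τ)/η(49τ)` at the level-49
# Heegner points: `∏_{[𝔞_Q] ∈ X} ‖η(τ_Q)/η(49τ_Q)‖² = 7^{#X}` for every `𝔫`-translate-stable set of classes `X`

Cell `bsd-goldfeld`, seat `bsd-goldfeld-s1p-c301` (prover, gen 14); ORDER «LINE U — UNIT CIRCLE on 𝒮|σ=−1» (planner (cliii));
`--supports stmt-BirchSwinnertonDyer-19140` (twin″) as a HELPER; memo `HOME/INERT7-UNIT-CIRCLE.md` §2 (U1). FACT-FREE: the only named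
fact, ty's (F-η) `x049_x_sub_two_eq_etaQuotient`, enters as the explicit binder `hEta` of the two `x − 2` corollaries.
Setting: `K` imaginary quadratic with the Heegner hypothesis at `N = 49`, `H` a Heegner datum (residue `β`; representatives `H.reps`
of the `Γ₀(49)`-classes of Heegner forms `Q = (A, B, C)`, `49 ∣ A`, `B ≡ β (98)`), `[𝔞_Q] = heegnerFormClass hK Q ∈ Cl(𝒪_{d_K})`,
`𝔫 = [𝔞_{(49, β, (β²−d_K)/196)}]` the level class. §1 `Φ(τ) := ‖Δ(τ)‖·(Im τ)⁶` is `SL₂(ℤ)`-invariant (Mathlib: `Δ = η²⁴` is the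
level-one cusp form `CuspForm.discriminant`). §2 The form `Q' = (A/49, B, 49C)`: `τ_{Q'} = 49·τ_Q` literally, `Q'` is primitive
positive definite, `[𝔞_{Q'}] = [𝔞_Q]·𝔫⁻¹` (tree `classOf'_eq_mul_levelForm`), and `Φ(τ_Q)` depends only on `[𝔞_Q]` (Cox Thm. 7.7 +
tree `exists_sl2_smul_heegnerTau_eq_heegnerTau_act`). §3 `Q ↦ [𝔞_Q]` maps `H.reps` ONTO `Cl(𝒪_{d_K})` (injective by the tree;
`#H.reps = h_K = h(d_K) = #Cl(𝒪_{d_K})` by three tree theorems). §4 **`prod_norm_eta_div_eta_sq_eq_seven_pow`**: for every predicate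
`p` on classes stable under `c ↦ c·𝔫⁻¹`, `∏_{Q ∈ H.reps, p[𝔞_Q]} ‖η(τ_Q)/η(49τ_Q)‖² = 7^{#}` — because `‖η(τ_Q)‖²⁴(Im τ_Q)⁶ = Φ(τ_Q)`
and `‖η(49τ_Q)‖²⁴49⁶(Im τ_Q)⁶ = Φ(τ_{Q'}) = Φ(τ_{ρQ})` for the representative `ρQ` of `[𝔞_Q]𝔫⁻¹`, and `ρ` permutes the index set;
coset form `…_sqCoset` (cosets `Cl²γ₀` = `Gal(H/F)`-orbits, `F` the genus field; `𝔫` is a square at the square level `49`) and the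
`x − 2` forms `prod_norm_x_sub_two_sq_eq_seven_pow (hEta)` / `…_sqCoset`. What this feeds (U2–U4, NOT done here): with Deuring's
factorisation (F-D), the genus norm `N_{H/F}(x(y) − 2)` gets the explicit class `ζ·λ·(1+i)·√a` (memo §3).
HONEST FRAMING: an identity between absolute values of CM values of a modular unit (and, under (F-η), of `x`-coordinates of Heegner
points on `X₀(49)`); no `L`-value, Selmer group or case of twin″ / K12₂″ is touched; BSD is not proved by any of this.
References: D. A. Cox, *Primes of the form x² + ny²* (2013), §3.A Lemma 3.2, §7.B Thm. 7.7 [Cox2013]; B. Gross, *Heegner points on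
X₀(N)* (1984), §I.1 [Gross1984]; F. Diamond, J. Shurman, *A First Course in Modular Forms*, §1.2 [DiamondShurman2005]; G. Ligozat,
*Courbes modulaires de genre 1*, Mém. SMF 43 (1975) [Ligozat1975].
-/

noncomputable section

open scoped Classical MatrixGroups UpperHalfPlane

open Complex UpperHalfPlane NumberField
open Literature.NumberTheory.EllipticCurves Literature.NumberTheory.EllipticCurves.ModularForms
open Literature.NumberTheory.QuadraticFields.Quadratic
open Literature.Computability.Cryptography.Hallgren2005 Literature.Computability.Cryptography.Hallgren2005.OrderCl

namespace Summit.BirchSwinnertonDyer.BirchSwinnertonDyer.Theorems.GoldfeldGoodTwists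

/-- **`Φ(γτ) = Φ(τ)` for `γ ∈ SL₂(ℤ)`**, `Φ(τ) := ‖Δ(τ)‖·(Im τ)⁶`: `Δ(γτ) = (cτ+d)¹²Δ(τ)` (Mathlib's level-one cusp form
`CuspForm.discriminant`) and `Im γτ = Im τ/|cτ+d|²`. [cite: DiamondShurman2005, §1.2] -/
theorem norm_discriminant_mul_im_pow_six_smul (g : SL(2, ℤ)) (τ : ℍ) :
    ‖ModularForm.discriminant (g • τ)‖ * (g • τ).im ^ 6 = ‖ModularForm.discriminant τ‖ * τ.im ^ 6 := by
  have h1 : ModularForm.discriminant (g • τ) = (denom (g : GL (Fin 2) ℝ) τ) ^ (12 : ℤ) * ModularForm.discriminant τ := by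
    simpa using SlashInvariantForm.slash_action_eqn'' (CuspForm.discriminant) (γ := (g : GL (Fin 2) ℝ))
      (MonoidHom.mem_range.mpr ⟨g, rfl⟩) τ
  have hpos : 0 < ‖denom (g : GL (Fin 2) ℝ) τ‖ := norm_pos_iff.mpr (denom_ne_zero _ _)
  rw [ModularGroup.im_smul_eq_div_normSq g τ, h1, norm_mul, norm_zpow, Complex.normSq_eq_norm_sq]
  field_simp

/-- **`τ_{(A/49, B, 49C)} = 49·τ_{(A,B,C)}`** as complex numbers (positive definite form, `49 ∣ A`). [cite: Gross1984, §I.1] -/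
theorem coe_heegnerTau_divLevel {Q : ℤ × ℤ × ℤ} (hA : 0 < Q.1) (hD : Q.2.1 ^ 2 - 4 * Q.1 * Q.2.2 < 0)
    (h49 : (49 : ℤ) ∣ Q.1) :
    ((heegnerTau (Q.1 / 49, Q.2.1, Q.2.2 * 49) : ℍ) : ℂ) = 49 * ((heegnerTau Q : ℍ) : ℂ) := by
  obtain ⟨A', hA'⟩ := h49
  have h1 : Q.1 / 49 = A' := by rw [hA']; simp
  have hA'pos : 0 < A' := by
    rcases lt_trichotomy A' 0 with h | h | h
    · nlinarith
    · subst h; simp at hA'; omega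
    · exact h
  have hD' : (Q.1 / 49, Q.2.1, Q.2.2 * 49).2.1 ^ 2 - 4 * (Q.1 / 49, Q.2.1, Q.2.2 * 49).1 *
      (Q.1 / 49, Q.2.1, Q.2.2 * 49).2.2 < 0 := by
    simp only [h1]; nlinarith
  rw [coe_heegnerTau (Q := (Q.1 / 49, Q.2.1, Q.2.2 * 49)) (by simp only [h1]; exact hA'pos) hD', coe_heegnerTau hA hD]
  apply Complex.ext
  · simp only [Complex.mul_re, h1]
    norm_num
    rw [hA']; push_cast
    field_simp
  · simp only [Complex.mul_im, h1]
    norm_num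
    rw [show (4 * (A' : ℝ) * (Q.2.2 * 49) - (Q.2.1 : ℝ) ^ 2) = 4 * (Q.1 : ℝ) * Q.2.2 - (Q.2.1 : ℝ) ^ 2 by
      rw [hA']; push_cast; ring, hA']
    push_cast
    field_simp

/-- In `ℍ`: `ofComplex (49·τ_Q) = τ_{(A/49, B, 49C)}` — the point at which (F-η) evaluates `η(49τ)`. [cite: Gross1984, §I.1] -/
theorem ofComplex_fortyNine_mul_heegnerTau {Q : ℤ × ℤ × ℤ} (hA : 0 < Q.1) (hD : Q.2.1 ^ 2 - 4 * Q.1 * Q.2.2 < 0)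
    (h49 : (49 : ℤ) ∣ Q.1) :
    UpperHalfPlane.ofComplex (49 * ((heegnerTau Q : ℍ) : ℂ)) = heegnerTau (Q.1 / 49, Q.2.1, Q.2.2 * 49) := by
  have him : 0 < (49 * ((heegnerTau Q : ℍ) : ℂ)).im := by
    rw [← coe_heegnerTau_divLevel hA hD h49]; exact (heegnerTau _).im_pos
  rw [UpperHalfPlane.ofComplex_apply_of_im_pos him]
  exact UpperHalfPlane.ext (by simp [coe_heegnerTau_divLevel hA hD h49])

/-- `Im τ_{(A/49, B, 49C)} = 49·Im τ_{(A,B,C)}`. [cite: Gross1984, §I.1] -/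
theorem im_heegnerTau_divLevel {Q : ℤ × ℤ × ℤ} (hA : 0 < Q.1) (hD : Q.2.1 ^ 2 - 4 * Q.1 * Q.2.2 < 0)
    (h49 : (49 : ℤ) ∣ Q.1) : (heegnerTau (Q.1 / 49, Q.2.1, Q.2.2 * 49)).im = 49 * (heegnerTau Q).im := by
  have h := congrArg Complex.im (coe_heegnerTau_divLevel hA hD h49)
  rw [UpperHalfPlane.coe_im] at h
  rw [h, Complex.mul_im]
  simp [UpperHalfPlane.coe_im]

/-- For a Heegner form `Q = (A, B, C)` of level `49`, discriminant `D`, `7 ∤ D`: `(A/49, B, 49C)` is primitive positive definite of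
discriminant `D` (`S`-equivalent to the Fricke image `(49C, −B, A/49)`, tree `HeegnerForm.fricke_mem_heegnerForms`). [cite: Gross1984, §I.1] -/
theorem isPosPrim_divLevel (Δ : NegDiscr) (hND : ∀ p : ℕ, p.Prime → p ∣ 49 → ¬ (p : ℤ) ∣ Δ.D) {Q : ℤ × ℤ × ℤ}
    (hQ : Q ∈ heegnerForms 49 Δ.D) : (⟨Q.1 / 49, Q.2.1, Q.2.2 * 49⟩ : BinQF).IsPosPrim Δ.D := by
  have hfr := HeegnerForm.fricke_mem_heegnerForms (N := 49) Δ.neg hND hQ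
  have hpp : (⟨(HeegnerForm.fricke 49 Q).1, (HeegnerForm.fricke 49 Q).2.1, (HeegnerForm.fricke 49 Q).2.2⟩ : BinQF).IsPosPrim
      Δ.D := ⟨hfr.1, hfr.2.1, (BinQF.isPrimitive_iff _).mpr hfr.2.2.2⟩
  simpa [HeegnerForm.fricke] using (BinQF.properEquiv_S (⟨(HeegnerForm.fricke 49 Q).1, (HeegnerForm.fricke 49 Q).2.1,
    (HeegnerForm.fricke 49 Q).2.2⟩ : BinQF)).isPosPrim Δ.neg hpp

variable {K : Type*} [Field K] [NumberField K]

/-- **`[𝔞_{(A/49, B, 49C)}] = [𝔞_Q]·𝔫⁻¹`** for a representative `Q = (A, B, C)`: concordant composition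
`[𝔞_Q] = [𝔞_{(A/49,B,49C)}]·[𝔞_{(49,B,AC/49)}]` (tree `classOf'_eq_mul_levelForm`) and `[𝔞_{(49,B,AC/49)}] = 𝔫` (tree
`heegnerFormClass_levelForm_eq_datum`). [cite: Cox2013, §3.A Lemma 3.2 with §7.B Thm. 7.7] -/
theorem heegnerFormClass_divLevel (hK : IsImaginaryQuadratic K) (hH : SatisfiesHeegnerHypothesis 49 K)
    (H : HeegnerDatum 49 (NumberField.discr K)) {Q : ℤ × ℤ × ℤ} (hQ : Q ∈ H.reps) :
    heegnerFormClass hK (Q.1 / 49, Q.2.1, Q.2.2 * 49) =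
      heegnerFormClass hK Q * (heegnerFormClass hK ((49 : ℤ), H.β, (H.β ^ 2 - NumberField.discr K) / (4 * 49)))⁻¹ := by
  have hND : ∀ p : ℕ, p.Prime → p ∣ 49 → ¬ (p : ℤ) ∣ NumberField.discr K :=
    fun p hp hpN ↦ not_dvd_discr_of_satisfiesHeegnerHypothesis hK hH hp hpN
  obtain ⟨hQf, -⟩ := H.mem_heegnerForms Q hQ
  have h1 := heegnerFormClass_levelForm_eq_datum hK hND H hQ
  have h2 := classOf'_eq_mul_levelForm (N := 49) hK.negDiscr hND (Q := Q) (by simpa using hQf)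
  simp only [Nat.cast_ofNat] at h1 h2
  rw [← h1, heegnerFormClass_def, heegnerFormClass_def, heegnerFormClass_def, h2, mul_inv_cancel_right]

/-- **`Φ(τ_Q)` depends only on `[𝔞_Q]`**: same class ⇒ properly equivalent (Cox Thm. 7.7, tree `classOf'_eq_classOf'_iff_properEquiv`)
⇒ `SL₂(ℤ)`-related CM points (tree `exists_sl2_smul_heegnerTau_eq_heegnerTau_act`) ⇒ same `Φ` (§1). [cite: Cox2013, §7.B Thm. 7.7] -/
theorem normDelta_mul_im_pow_eq_of_classOf'_eq (Δ : NegDiscr) {Q R : ℤ × ℤ × ℤ}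
    (hQ : (⟨Q.1, Q.2.1, Q.2.2⟩ : BinQF).IsPosPrim Δ.D) (hR : (⟨R.1, R.2.1, R.2.2⟩ : BinQF).IsPosPrim Δ.D)
    (h : classOf' Δ ⟨Q.1, Q.2.1, Q.2.2⟩ = classOf' Δ ⟨R.1, R.2.1, R.2.2⟩) :
    ‖ModularForm.discriminant (heegnerTau Q)‖ * (heegnerTau Q).im ^ 6 =
      ‖ModularForm.discriminant (heegnerTau R)‖ * (heegnerTau R).im ^ 6 := by
  obtain ⟨A, B, C⟩ := Q
  obtain ⟨A', B', C'⟩ := R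
  obtain ⟨p, q, r, s, hdet, hact⟩ := (classOf'_eq_classOf'_iff_properEquiv Δ hQ hR).mp h
  have hdisc : (⟨A, B, C⟩ : BinQF).disc < 0 := by rw [hQ.disc_eq]; exact Δ.neg
  obtain ⟨γ, hγ⟩ := exists_sl2_smul_heegnerTau_eq_heegnerTau_act ⟨A, B, C⟩ hQ.a_pos hdisc hdet
  have hR' : heegnerTau (A', B', C') = heegnerTau (((⟨A, B, C⟩ : BinQF).act p q r s).a,
      ((⟨A, B, C⟩ : BinQF).act p q r s).b, ((⟨A, B, C⟩ : BinQF).act p q r s).c) := by rw [← hact]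
  change ‖ModularForm.discriminant (heegnerTau (A, B, C))‖ * (heegnerTau (A, B, C)).im ^ 6 =
    ‖ModularForm.discriminant (heegnerTau (A', B', C'))‖ * (heegnerTau (A', B', C')).im ^ 6
  rw [hR', ← hγ, norm_discriminant_mul_im_pow_six_smul]

/-- `‖η(49τ_Q)‖²⁴ · 49⁶(Im τ_Q)⁶ = Φ(τ_{(A/49,B,49C)})` (`Δ = η²⁴`, §2). [cite: DiamondShurman2005, §1.2] -/
theorem norm_eta_fortyNine_pow_mul {Q : ℤ × ℤ × ℤ} (hA : 0 < Q.1) (hD : Q.2.1 ^ 2 - 4 * Q.1 * Q.2.2 < 0)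
    (h49 : (49 : ℤ) ∣ Q.1) :
    ‖ModularForm.eta (UpperHalfPlane.ofComplex (49 * ((heegnerTau Q : ℍ) : ℂ)))‖ ^ 24 * (49 ^ 6 * (heegnerTau Q).im ^ 6) =
      ‖ModularForm.discriminant (heegnerTau (Q.1 / 49, Q.2.1, Q.2.2 * 49))‖ *
        (heegnerTau (Q.1 / 49, Q.2.1, Q.2.2 * 49)).im ^ 6 := by
  rw [ofComplex_fortyNine_mul_heegnerTau hA hD h49, im_heegnerTau_divLevel hA hD h49, ModularForm.discriminant, norm_pow]
  ring

/-- A discriminant carrying a Heegner datum of level `49` is `≡ 0, 1 (mod 4)` (`D ≡ β² (mod 196)`). [folklore] -/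
theorem discr_emod_four_of_heegnerDatum {D : ℤ} (H : HeegnerDatum 49 D) : D % 4 = 0 ∨ D % 4 = 1 := by
  obtain ⟨c, hc⟩ := H.dvd_sq_sub
  push_cast at hc
  have hD : D = H.β ^ 2 - 4 * (49 * c) := by linarith
  rcases Int.even_or_odd H.β with ⟨k, hk⟩ | hodd
  · exact Or.inl (by rw [hD, hk, show (k + k) ^ 2 - 4 * (49 * c) = 4 * (k * k - 49 * c) by ring, Int.mul_emod_right])
  · exact Or.inr (by have h1 := Int.sq_mod_four_eq_one_of_odd hodd; omega)

/-- **`Q ↦ [𝔞_Q]` maps `H.reps` onto `Cl(𝒪_{d_K})`**: injective (tree `heegnerFormClass_injective_reps`) between finite sets of equal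
size `#H.reps = h_K = h(d_K) = #Cl(𝒪_{d_K})` (tree `HeegnerDatum.card_reps_eq_classNumber_holds`, `card_reducedForms_eq_classNumber`,
`natCard_classGroup_QO_of_emod_four`). [cite: Gross1984, §I.1] -/
theorem exists_mem_reps_heegnerFormClass_eq (hK : IsImaginaryQuadratic K) (hH : SatisfiesHeegnerHypothesis 49 K)
    (H : HeegnerDatum 49 (NumberField.discr K)) (c : ClassGroup (OrderCl.QO hK.negDiscr)) :
    ∃ R ∈ H.reps, heegnerFormClass hK R = c := by
  have hD4 : hK.negDiscr.D % 4 = 0 ∨ hK.negDiscr.D % 4 = 1 := discr_emod_four_of_heegnerDatum H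
  haveI : Finite (ClassGroup (OrderCl.QO hK.negDiscr)) :=
    Literature.NumberTheory.ComplexMultiplication.CMTypeLattice.finite_classGroup_QO_of_emod_four hK.negDiscr hD4
  have hcard : Nat.card (ClassGroup (OrderCl.QO hK.negDiscr)) ≤ Nat.card H.reps := by
    rw [Literature.NumberTheory.ComplexMultiplication.CMTypeLattice.natCard_classGroup_QO_of_emod_four hK.negDiscr hD4,
      IsImaginaryQuadratic.negDiscr_D, Literature.NumberTheory.QuadraticFields.Quadratic.card_reducedForms_eq_classNumber
        hK.finrank_eq_two hK.discr_neg, ← HeegnerDatum.card_reps_eq_classNumber_holds 49 K hK hH H, Nat.card_eq_fintype_card,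
      Fintype.card_coe]
  obtain ⟨⟨R, hR⟩, hRc⟩ := ((heegnerFormClass_injective_reps hK H).bijective_of_nat_card_le hcard).2 c
  exact ⟨R, hR, hRc⟩

/-- **THE UNIT-CIRCLE LEMMA (memo INERT7-UNIT-CIRCLE §2, (U1)); FACT-FREE.** For `K` imaginary quadratic with the Heegner hypothesis
at `49`, a Heegner datum `H` and a predicate `p` on `Cl(𝒪_{d_K})` stable under `c ↦ c·𝔫⁻¹` (`𝔫` the level class):
`∏_{Q ∈ H.reps, p[𝔞_Q]} ‖η(τ_Q)/η(49τ_Q)‖² = 7^{#{Q ∈ H.reps : p[𝔞_Q]}}`. Proof: `‖η(τ_Q)‖²⁴(Im τ_Q)⁶ = Φ(τ_Q)`,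
`‖η(49τ_Q)‖²⁴49⁶(Im τ_Q)⁶ = Φ(τ_{ρQ})` with `ρQ ∈ H.reps` the representative of `[𝔞_Q]𝔫⁻¹` (§2–§3); `ρ` permutes the index set, so
`∏‖η(τ_Q)‖²⁴ = 49^{6#}∏‖η(49τ_Q)‖²⁴`; take `12`-th roots. [cite: Gross1984, §I.1] [cite: Cox2013, §7.B Thm. 7.7] -/
theorem prod_norm_eta_div_eta_sq_eq_seven_pow (hK : IsImaginaryQuadratic K) (hH : SatisfiesHeegnerHypothesis 49 K)
    (H : HeegnerDatum 49 (NumberField.discr K)) (p : ClassGroup (OrderCl.QO hK.negDiscr) → Prop)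
    (hp : ∀ c, p (c * (heegnerFormClass hK ((49 : ℤ), H.β, (H.β ^ 2 - NumberField.discr K) / (4 * 49)))⁻¹) ↔ p c) :
    ∏ Q ∈ H.reps.filter (fun Q ↦ p (heegnerFormClass hK Q)),
        ‖ModularForm.eta (heegnerTau Q) / ModularForm.eta (UpperHalfPlane.ofComplex (49 * ((heegnerTau Q : ℍ) : ℂ)))‖ ^ 2 =
      7 ^ (H.reps.filter (fun Q ↦ p (heegnerFormClass hK Q))).card := by
  have hND : ∀ p : ℕ, p.Prime → p ∣ 49 → ¬ (p : ℤ) ∣ NumberField.discr K :=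
    fun p hp hpN ↦ not_dvd_discr_of_satisfiesHeegnerHypothesis hK hH hp hpN
  set n := heegnerFormClass hK ((49 : ℤ), H.β, (H.β ^ 2 - NumberField.discr K) / (4 * 49)) with hn
  set F := H.reps.filter (fun Q ↦ p (heegnerFormClass hK Q)) with hF
  have hrep : ∀ Q ∈ H.reps, 0 < Q.1 ∧ Q.2.1 ^ 2 - 4 * Q.1 * Q.2.2 < 0 ∧ (49 : ℤ) ∣ Q.1 := fun Q hQ ↦ by
    obtain ⟨⟨hdisc, hA, h49, -⟩, -⟩ := H.mem_heegnerForms Q hQ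
    exact ⟨hA, hdisc ▸ hK.discr_neg, by exact_mod_cast h49⟩
  -- the translate `ρ Q ∈ H.reps`: the representative of the class `[𝔞_Q]·𝔫⁻¹`; it permutes `F`
  have hex : ∀ Q ∈ H.reps, ∃ R ∈ H.reps, heegnerFormClass hK R = heegnerFormClass hK Q * n⁻¹ :=
    fun Q _ ↦ exists_mem_reps_heegnerFormClass_eq hK hH H _
  choose! ρ hρ_mem hρ_class using hex
  have hρ_F : ∀ Q ∈ F, ρ Q ∈ F := fun Q hQ ↦ by
    rw [hF, Finset.mem_filter] at hQ ⊢
    exact ⟨hρ_mem Q hQ.1, by rw [hρ_class Q hQ.1]; exact (hp _).mpr hQ.2⟩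
  have hρ_inj : Set.InjOn ρ F := fun Q₁ hQ₁ Q₂ hQ₂ h ↦ by
    rw [hF, Finset.coe_filter] at hQ₁ hQ₂
    have h' := congrArg (heegnerFormClass hK) h
    rw [hρ_class Q₁ hQ₁.1, hρ_class Q₂ hQ₂.1] at h'
    exact heegnerFormClass_injOn_reps hK H hQ₁.1 hQ₂.1 (mul_right_cancel h')
  -- pointwise: `‖η(49τ_Q)‖²⁴·49⁶(Im τ_Q)⁶ = Φ(τ_{ρ Q})`
  have hpt : ∀ Q ∈ H.reps, ‖ModularForm.eta (UpperHalfPlane.ofComplex (49 * ((heegnerTau Q : ℍ) : ℂ)))‖ ^ 24 *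
      (49 ^ 6 * (heegnerTau Q).im ^ 6) = ‖ModularForm.discriminant (heegnerTau (ρ Q))‖ * (heegnerTau (ρ Q)).im ^ 6 := by
    intro Q hQ
    obtain ⟨hA, hD, h49⟩ := hrep Q hQ
    rw [norm_eta_fortyNine_pow_mul hA hD h49]
    obtain ⟨hQf, -⟩ := H.mem_heegnerForms Q hQ
    obtain ⟨hRf, -⟩ := H.mem_heegnerForms (ρ Q) (hρ_mem Q hQ)
    have hcl : heegnerFormClass hK (Q.1 / 49, Q.2.1, Q.2.2 * 49) = heegnerFormClass hK (ρ Q) := by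
      rw [hρ_class Q hQ]; exact heegnerFormClass_divLevel hK hH H hQ
    simp only [heegnerFormClass_def] at hcl
    exact normDelta_mul_im_pow_eq_of_classOf'_eq hK.negDiscr (Q := (Q.1 / 49, Q.2.1, Q.2.2 * 49)) (R := ρ Q)
      (isPosPrim_divLevel hK.negDiscr hND hQf) ⟨hRf.1, hRf.2.1, (BinQF.isPrimitive_iff _).mpr hRf.2.2.2⟩ hcl
  -- products: `∏ Φ(τ_Q) = ∏ Φ(τ_{ρQ})`
  have hP : ∏ Q ∈ F, ‖ModularForm.eta (heegnerTau Q)‖ ^ 24 * (heegnerTau Q).im ^ 6 =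
      ∏ Q ∈ F, ‖ModularForm.eta (UpperHalfPlane.ofComplex (49 * ((heegnerTau Q : ℍ) : ℂ)))‖ ^ 24 *
        (49 ^ 6 * (heegnerTau Q).im ^ 6) := by
    rw [Finset.prod_congr rfl fun Q hQ ↦ hpt Q (Finset.mem_filter.mp hQ).1, Finset.prod_congr rfl
      fun Q _ ↦ (show ‖ModularForm.eta (heegnerTau Q)‖ ^ 24 * (heegnerTau Q).im ^ 6 =
        ‖ModularForm.discriminant (heegnerTau Q)‖ * (heegnerTau Q).im ^ 6 by rw [ModularForm.discriminant, norm_pow])]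
    exact (Finset.prod_nbij ρ hρ_F hρ_inj (Finset.surjOn_of_injOn_of_card_le ρ hρ_F hρ_inj le_rfl) (fun _ _ ↦ rfl)).symm
  rw [Finset.prod_mul_distrib, Finset.prod_mul_distrib, Finset.prod_mul_distrib, Finset.prod_const, mul_left_comm,
    ← mul_assoc] at hP
  have hIm : (0 : ℝ) < ∏ Q ∈ F, (heegnerTau Q).im ^ 6 := Finset.prod_pos fun Q _ ↦ pow_pos (heegnerTau Q).im_pos 6
  have hkey : ∏ Q ∈ F, ‖ModularForm.eta (heegnerTau Q)‖ ^ 24 =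
      ((49 : ℝ) ^ 6) ^ F.card * ∏ Q ∈ F, ‖ModularForm.eta (UpperHalfPlane.ofComplex (49 * ((heegnerTau Q : ℍ) : ℂ)))‖ ^ 24 :=
    mul_right_cancel₀ hIm.ne' hP
  -- conclude by taking `12`-th roots
  have hden : ∏ Q ∈ F, ‖ModularForm.eta (UpperHalfPlane.ofComplex (49 * ((heegnerTau Q : ℍ) : ℂ)))‖ ^ 24 ≠ 0 :=
    Finset.prod_ne_zero_iff.mpr fun Q _ ↦ pow_ne_zero _
      (norm_ne_zero_iff.mpr (ModularForm.eta_ne_zero (UpperHalfPlane.ofComplex _).2))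
  have h12 : (∏ Q ∈ F, ‖ModularForm.eta (heegnerTau Q) /
      ModularForm.eta (UpperHalfPlane.ofComplex (49 * ((heegnerTau Q : ℍ) : ℂ)))‖ ^ 2) ^ 12 = ((7 : ℝ) ^ F.card) ^ 12 := by
    rw [← Finset.prod_pow, Finset.prod_congr rfl fun Q _ ↦ (show (‖ModularForm.eta (heegnerTau Q) /
        ModularForm.eta (UpperHalfPlane.ofComplex (49 * ((heegnerTau Q : ℍ) : ℂ)))‖ ^ 2) ^ 12 =
        ‖ModularForm.eta (heegnerTau Q)‖ ^ 24 / ‖ModularForm.eta (UpperHalfPlane.ofComplex (49 * ((heegnerTau Q : ℍ) : ℂ)))‖ ^ 24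
        by rw [← pow_mul, norm_div, div_pow]), Finset.prod_div_distrib, hkey, mul_div_cancel_right₀ _ hden, ← pow_mul,
      ← pow_mul, show (49 : ℝ) = 7 ^ 2 by norm_num, ← pow_mul]
    congr 1
    ring
  exact (pow_left_inj₀ (Finset.prod_nonneg fun _ _ ↦ sq_nonneg _) (by positivity) (by norm_num)).mp h12

/-- A coset `Cl²γ₀` of the squares is stable under `c ↦ c·ν⁻¹` for a square `ν`. [cite: Cox2013, §3.B (principal genus)] -/
theorem sqCoset_stable_mul_inv {G : Type*} [CommGroup G] {ν γ₀ : G} (hν : ∃ μ, ν = μ ^ 2) (c : G) :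
    (∃ δ, c * ν⁻¹ = δ ^ 2 * γ₀) ↔ ∃ δ, c = δ ^ 2 * γ₀ := by
  obtain ⟨μ, rfl⟩ := hν
  refine ⟨fun ⟨δ, hδ⟩ ↦ ⟨δ * μ, ?_⟩, fun ⟨δ, hδ⟩ ↦ ⟨δ * μ⁻¹, by rw [hδ, mul_pow, inv_pow, mul_right_comm]⟩⟩
  rw [mul_inv_eq_iff_eq_mul] at hδ
  rw [hδ, mul_pow, mul_right_comm]

/-- **At the square level `49 = 7²` the level class `𝔫` is a square** (tree `heegnerFormClass_levelForm_eq_sq`, applied to the level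
form `(49, β, (β² − d_K)/196)` itself). [cite: Gross1984, §I.1] -/
theorem exists_levelClass_eq_sq (hK : IsImaginaryQuadratic K) (hH : SatisfiesHeegnerHypothesis 49 K)
    (H : HeegnerDatum 49 (NumberField.discr K)) :
    ∃ μ, heegnerFormClass hK ((49 : ℤ), H.β, (H.β ^ 2 - NumberField.discr K) / (4 * 49)) = μ ^ 2 := by
  have hND : ∀ p : ℕ, p.Prime → p ∣ 49 → ¬ (p : ℤ) ∣ NumberField.discr K :=
    fun p hp hpN ↦ not_dvd_discr_of_satisfiesHeegnerHypothesis hK hH hp hpN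
  have h := heegnerFormClass_levelForm_eq_sq (N := 49) (n := 7) hK (by norm_num) hND (levelForm_mem_heegnerForms (N := 49) hND H)
  simp only [Nat.cast_ofNat] at h
  norm_num at h
  exact ⟨_, h⟩

/-- **Unit circle on genus cosets**: for every coset `X = Cl(𝒪_{d_K})²·γ₀` (a `Gal(H/F)`-orbit, `F` the genus field),
`∏_{[𝔞_Q] ∈ X} ‖η(τ_Q)/η(49τ_Q)‖² = 7^{#X}`: the genus norm `N_{H/F}(η(τ)/η(49τ))` has modulus `7^{#X/2}` at `H ⊂ ℂ`. [cite: Gross1984, §I.1] -/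
theorem prod_norm_eta_div_eta_sq_sqCoset (hK : IsImaginaryQuadratic K) (hH : SatisfiesHeegnerHypothesis 49 K)
    (H : HeegnerDatum 49 (NumberField.discr K)) (γ₀ : ClassGroup (OrderCl.QO hK.negDiscr)) :
    ∏ Q ∈ H.reps.filter (fun Q ↦ ∃ δ, heegnerFormClass hK Q = δ ^ 2 * γ₀),
        ‖ModularForm.eta (heegnerTau Q) / ModularForm.eta (UpperHalfPlane.ofComplex (49 * ((heegnerTau Q : ℍ) : ℂ)))‖ ^ 2 =
      7 ^ (H.reps.filter (fun Q ↦ ∃ δ, heegnerFormClass hK Q = δ ^ 2 * γ₀)).card :=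
  prod_norm_eta_div_eta_sq_eq_seven_pow hK hH H (fun c ↦ ∃ δ, c = δ ^ 2 * γ₀)
    (fun c ↦ sqCoset_stable_mul_inv (exists_levelClass_eq_sq hK hH H) c)

/-- **The `x − 2` form (consumer of (F-η) BY NAME).** Granted `hEta : x049_x_sub_two_eq_etaQuotient` (Ligozat: `x(φ(τ)) − 2 =
η(τ)/η(49τ)` for an optimal parametrisation `φ = D.φ` of `X₀(49) → 49a1`): for ANY affine coordinates `(x_Q, y_Q)` of the Heegner
points `φ(τ_Q)`, `Q ∈ H.reps`, and every `p` stable under `c ↦ c·𝔫⁻¹`: `∏_{p[𝔞_Q]} ‖x_Q − 2‖² = 7^{#}`.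
[cite: Ligozat1975, Prop. 3.1.1 and table N = 49 (p. 45)] [cite: Gross1984, §I.1] -/
theorem prod_norm_x_sub_two_sq_eq_seven_pow (hEta : x049_x_sub_two_eq_etaQuotient) (hK : IsImaginaryQuadratic K)
    (hH : SatisfiesHeegnerHypothesis 49 K) (H : HeegnerDatum 49 (NumberField.discr K))
    (p : ClassGroup (OrderCl.QO hK.negDiscr) → Prop)
    (hp : ∀ c, p (c * (heegnerFormClass hK ((49 : ℤ), H.β, (H.β ^ 2 - NumberField.discr K) / (4 * 49)))⁻¹) ↔ p c)
    (D : ModularParametrizationData cm7 49) (hc : |D.c| = 1) (x y : ℤ × ℤ × ℤ → ℂ)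
    (hxy : ∀ Q ∈ H.reps, ∃ h, D.φ (heegnerTau Q) = .some (x Q) (y Q) h) :
    ∏ Q ∈ H.reps.filter (fun Q ↦ p (heegnerFormClass hK Q)), ‖x Q - 2‖ ^ 2 =
      7 ^ (H.reps.filter (fun Q ↦ p (heegnerFormClass hK Q))).card := by
  rw [← prod_norm_eta_div_eta_sq_eq_seven_pow hK hH H p hp]
  refine Finset.prod_congr rfl fun Q hQ ↦ ?_
  obtain ⟨h, hφ⟩ := hxy Q (Finset.mem_filter.mp hQ).1
  obtain ⟨y', h', hφ'⟩ := hEta D hc (heegnerTau Q)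
  rw [hφ] at hφ'
  rw [((WeierstrassCurve.Affine.Point.some.injEq _ _ _ _ _ _).mp hφ').1, add_sub_cancel_left]

/-- **The `x − 2` form on genus cosets**: granted (F-η), `∏_{[𝔞_Q] ∈ Cl²γ₀} ‖x_Q − 2‖² = 7^{#}` for any coordinates of the Heegner points of
an optimal parametrisation of `X₀(49) → 49a1` — the shape consumed by file U2 (`u_F·ū_F = 7^{h/4}`).
[cite: Ligozat1975, Prop. 3.1.1 and table N = 49 (p. 45)] [cite: Gross1984, §I.1] -/
theorem prod_norm_x_sub_two_sq_sqCoset (hEta : x049_x_sub_two_eq_etaQuotient) (hK : IsImaginaryQuadratic K)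
    (hH : SatisfiesHeegnerHypothesis 49 K) (H : HeegnerDatum 49 (NumberField.discr K))
    (γ₀ : ClassGroup (OrderCl.QO hK.negDiscr)) (D : ModularParametrizationData cm7 49) (hc : |D.c| = 1)
    (x y : ℤ × ℤ × ℤ → ℂ) (hxy : ∀ Q ∈ H.reps, ∃ h, D.φ (heegnerTau Q) = .some (x Q) (y Q) h) :
    ∏ Q ∈ H.reps.filter (fun Q ↦ ∃ δ, heegnerFormClass hK Q = δ ^ 2 * γ₀), ‖x Q - 2‖ ^ 2 =
      7 ^ (H.reps.filter (fun Q ↦ ∃ δ, heegnerFormClass hK Q = δ ^ 2 * γ₀)).card :=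
  prod_norm_x_sub_two_sq_eq_seven_pow hEta hK hH H (fun c ↦ ∃ δ, c = δ ^ 2 * γ₀)
    (fun c ↦ sqCoset_stable_mul_inv (exists_levelClass_eq_sq hK hH H) c) D hc x y hxy

end Summit.BirchSwinnertonDyer.BirchSwinnertonDyer.Theorems.GoldfeldGoodTwists

end
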